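/-
Copyright (c) 2026. All rights reserved.
Released under Apache 2.0 license as described in the file LICENSE.
-/
import Mathlib
import HarnessLib
import Summits.RiemannHypothesis.RiemannHypothesis.Theorems.EarlyAppointmentsCombGHelpers
import Summits.RiemannHypothesis.RiemannHypothesis.Theorems.EarlyAppointmentsGDecompContinuity
import Summits.RiemannHypothesis.RiemannHypothesis.Theorems.EarlyAppointmentsGDecompFinsum
import Summits.RiemannHypothesis.RiemannHypothesis.Theorems.EarlyAppointmentsGDecompLimitDiff
import Literature.Geometry.Kaehler.AnalyticSetFiniteMaps

/-!
# G decomposition at the simple zero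

The key lemma: G(c).im ≤ -1/(2h) + comb_sum.im + η/s where c is a simple zero of f.
Uses finsum_im_bound from GDecompFinsum and bounded_diff_at_limit from GDecompLimitDiff.
-/

open Complex Real Set Filter Topology Metric
open scoped BigOperators Topology ComplexConjugate

noncomputable section

namespace GDecompLimit

variable {f : ℂ → ℂ} {x₀ h R η s : ℝ}

/-- The center point c = x₀ + ih. -/
abbrev c := GDecompFinsum.c
/-- The conjugate point conj(c) = x₀ - ih. -/
abbrev c_conj := GDecompFinsum.c_conj

/-- G(c).im ≤ conjugate_im + comb_im + η/s. -/
theorem G_im_decomp (hh : 0 < h) (_hR : 0 < R) (hhR : h < R) (hs : 0 < s) (hη : 0 ≤ η)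
    (hf_diff : Differentiable ℂ f)
    (hz₀ : f (c x₀ h) = 0) (hz₀_simple : deriv f (c x₀ h) ≠ 0)
    (hz₀_conj : f (c_conj x₀ h) = 0)
    (honly_pair : ∀ w : ℂ, ‖w - (x₀ : ℂ)‖ < R → f w = 0 → w.im ≠ 0 →
      (w = c x₀ h ∨ w = c_conj x₀ h))
    (hremainder : ∀ z : ℂ, ‖z - c x₀ h‖ ≤ h / 2 → f z ≠ 0 →
      ‖deriv f z / f z - ∑ᶠ w ∈ {w | f w = 0 ∧ ‖w - (x₀ : ℂ)‖ < R}, (z - w)⁻¹‖ ≤ η / s)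
    (S : Finset ℝ) (hS : ∀ ξ ∈ S, f (ξ : ℂ) = 0 ∧ |ξ - x₀| ≤ h) :
    let conjugate_im := -1 / (2 * h)
    let comb_im := ∑ ξ ∈ S, ((c x₀ h - (ξ : ℂ))⁻¹).im
    (EarlyAppointmentsCombGHelpers.G f (c x₀ h) (c x₀ h)).im ≤ conjugate_im + comb_im + η / s := by
  intro conjugate_im comb_im

  -- Define zeros and ext_pole_sum
  let zeros : Set ℂ := {w | f w = 0 ∧ ‖w - (x₀ : ℂ)‖ < R}
  let ext_pole_sum : ℂ → ℂ := fun z => ∑ᶠ w ∈ zeros, if w = c x₀ h then 0 else (z - w)⁻¹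

  -- zeros is finite (analytic function, not constant)
  have hf_not_const : ∃ w : ℂ, f w ≠ 0 := by
    by_contra hcontra; push Not at hcontra
    have hf_zero : f = 0 := funext hcontra
    have hderiv_zero : deriv f (c x₀ h) = 0 := by rw [hf_zero]; simp
    exact hz₀_simple hderiv_zero
  have hzeros_finite : Set.Finite zeros := by
    have hf_an : ∀ z : ℂ, AnalyticAt ℂ f z := fun z => hf_diff.analyticAt z
    set Z := {w : ℂ | f w = 0 ∧ ‖w - (x₀ : ℂ)‖ ≤ R} with hZ_def
    have hsubset : zeros ⊆ Z := fun w ⟨hw1, hw2⟩ => ⟨hw1, le_of_lt hw2⟩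
    have hZ_compact : IsCompact Z := by
      have h1 : IsClosed (f ⁻¹' {0}) := isClosed_singleton.preimage hf_diff.continuous
      have h2 : IsCompact (closedBall (x₀ : ℂ) R) := isCompact_closedBall (x₀ : ℂ) R
      have heq : Z = (f ⁻¹' {0}) ∩ closedBall (x₀ : ℂ) R := by
        ext w; simp only [hZ_def, mem_inter_iff, mem_preimage, mem_singleton_iff,
          mem_closedBall_iff_norm, mem_setOf_eq]
      rw [heq]; exact h2.inter_left h1
    apply Set.Finite.subset _ hsubset
    obtain ⟨w₀, hw₀⟩ := hf_not_const
    apply Literature.Geometry.Kaehler.SCV.finite_of_isCompact_of_eventually_notMem hZ_compact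
    intro z ⟨hzf, _hz_ball⟩
    have hf_an_z := hf_an z
    rcases hf_an_z.eventually_eq_zero_or_eventually_ne_zero with hconst | hisolated
    · exfalso
      have hf_an_univ : AnalyticOnNhd ℂ f Set.univ := fun w _ => hf_an w
      have hconn : IsPreconnected (Set.univ : Set ℂ) := isPreconnected_univ
      have hzero_all := AnalyticOnNhd.eqOn_zero_of_preconnected_of_eventuallyEq_zero
        hf_an_univ hconn (Set.mem_univ z) hconst
      exact hw₀ (hzero_all (Set.mem_univ w₀))
    · filter_upwards [hisolated] with w hw
      intro ⟨hwf, _⟩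
      exact hw hwf

  -- G continuous at c
  have h_G_cont : ContinuousAt (EarlyAppointmentsCombGHelpers.G f (c x₀ h)) (c x₀ h) :=
    EarlyAppointmentsCombGHelpers.G_analyticAt_of_simple_zero hf_diff hz₀ hz₀_simple |>.continuousAt

  -- ext_pole_sum continuous at c
  have h_ext_cont : ContinuousAt ext_pole_sum (c x₀ h) := by
    simp only [ext_pole_sum]
    have hfin := hzeros_finite
    rw [show (fun z => ∑ᶠ w ∈ zeros, if w = c x₀ h then 0 else (z - w)⁻¹) =
        (fun z => ∑ w ∈ hfin.toFinset, if w = c x₀ h then 0 else (z - w)⁻¹) by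
      ext z; rw [finsum_mem_eq_finite_toFinset_sum _ hfin]]
    apply tendsto_finsetSum
    intro w _
    by_cases heq : w = c x₀ h
    · simp only [heq, ↓reduceIte]; exact continuousAt_const
    · simp only [heq, ↓reduceIte]
      exact (continuousAt_id.sub continuousAt_const).inv₀ (sub_ne_zero.mpr (Ne.symm heq))

  -- c is in zeros
  have hc_in_zeros : c x₀ h ∈ zeros := by
    constructor
    · exact hz₀
    · simp only [c, GDecompFinsum.c]
      have heq : ((x₀ : ℂ) + h * I) - (x₀ : ℂ) = h * I := by ring
      rw [heq, norm_mul, Complex.norm_real, Complex.norm_I, mul_one, Real.norm_eq_abs, abs_of_pos hh]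
      exact hhR

  -- Bound on G - ext_pole_sum near c
  have h_G_ext_bound : ∃ δ > 0, ∀ z, 0 < ‖z - c x₀ h‖ → ‖z - c x₀ h‖ < δ →
      ‖EarlyAppointmentsCombGHelpers.G f (c x₀ h) z - ext_pole_sum z‖ ≤ η / s := by
    have hf_an : AnalyticAt ℂ f (c x₀ h) := hf_diff.analyticAt (c x₀ h)
    obtain ⟨p, hp⟩ := hf_an
    have hg_an : AnalyticAt ℂ (dslope f (c x₀ h)) (c x₀ h) := hp.has_fpower_series_dslope_fslope.analyticAt
    have hg_cont : ContinuousAt (dslope f (c x₀ h)) (c x₀ h) := hg_an.continuousAt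
    have hg_ne_zero : dslope f (c x₀ h) (c x₀ h) ≠ 0 := by simpa using hz₀_simple
    have hg_ne_evt : ∀ᶠ z in 𝓝 (c x₀ h), dslope f (c x₀ h) z ≠ 0 :=
      hg_cont.preimage_mem_nhds (isOpen_compl_singleton.mem_nhds hg_ne_zero)
    obtain ⟨δ₁, hδ₁_pos, hg_ne⟩ := Metric.eventually_nhds_iff.mp hg_ne_evt
    use min (h / 2) δ₁, lt_min (by linarith) hδ₁_pos
    intro z hz_pos hz_near
    have hz_near' : ‖z - c x₀ h‖ < h / 2 := lt_of_lt_of_le hz_near (min_le_left _ _)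
    have hz_near_δ₁ : ‖z - c x₀ h‖ < δ₁ := lt_of_lt_of_le hz_near (min_le_right _ _)
    have hz_ne_c : z ≠ c x₀ h := fun heq => by rw [heq, sub_self, norm_zero] at hz_pos; exact (lt_irrefl 0) hz_pos
    have hfz_ne : f z ≠ 0 := by
      have hgz_ne : dslope f (c x₀ h) z ≠ 0 := hg_ne (by rw [dist_comm, dist_eq_norm, norm_sub_rev]; exact hz_near_δ₁)
      have hf_factor := sub_smul_dslope f (c x₀ h) z
      simp only [hz₀, sub_zero, smul_eq_mul] at hf_factor
      rw [hf_factor.symm]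
      exact mul_ne_zero (sub_ne_zero.mpr hz_ne_c) hgz_ne
    have hG_eq := EarlyAppointmentsCombGHelpers.G_eq_logDeriv_sub hf_diff hz₀ hz_ne_c hfz_ne
    have hext_eq : ext_pole_sum z = (∑ᶠ w ∈ zeros, (z - w)⁻¹) - (z - c x₀ h)⁻¹ := by
      simp only [ext_pole_sum]
      rw [finsum_mem_eq_finite_toFinset_sum _ hzeros_finite, finsum_mem_eq_finite_toFinset_sum _ hzeros_finite]
      have hc_mem : c x₀ h ∈ hzeros_finite.toFinset := by rwa [Set.Finite.mem_toFinset]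
      rw [← Finset.add_sum_erase _ _ hc_mem]; simp only [↓reduceIte, zero_add]
      rw [← Finset.add_sum_erase _ _ hc_mem, add_sub_cancel_left]
      apply Finset.sum_congr rfl; intro w hw; simp only [Finset.ne_of_mem_erase hw, ↓reduceIte]
    rw [hG_eq, hext_eq]
    have hcancel : (deriv f z / f z - 1 / (z - c x₀ h)) - ((∑ᶠ w ∈ zeros, (z - w)⁻¹) - (z - c x₀ h)⁻¹) =
        deriv f z / f z - ∑ᶠ w ∈ zeros, (z - w)⁻¹ := by rw [one_div]; ring
    rw [hcancel]
    exact hremainder z (le_of_lt hz_near') hfz_ne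

  -- Apply bounded_diff_at_limit
  have hη_nonneg : 0 ≤ η / s := div_nonneg hη (le_of_lt hs)
  have h_G_ext_limit : ‖EarlyAppointmentsCombGHelpers.G f (c x₀ h) (c x₀ h) - ext_pole_sum (c x₀ h)‖ ≤ η / s :=
    GDecompLimitDiff.bounded_diff_at_limit hη_nonneg h_G_cont h_ext_cont h_G_ext_bound

  -- G(c).im ≤ ext_pole_sum(c).im + η/s
  have h_G_im_bound : (EarlyAppointmentsCombGHelpers.G f (c x₀ h) (c x₀ h)).im ≤
      (ext_pole_sum (c x₀ h)).im + η / s := by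
    have h1 : |(EarlyAppointmentsCombGHelpers.G f (c x₀ h) (c x₀ h)).im -
        (ext_pole_sum (c x₀ h)).im| ≤ η / s := by
      have h2 : (EarlyAppointmentsCombGHelpers.G f (c x₀ h) (c x₀ h)).im -
          (ext_pole_sum (c x₀ h)).im =
          (EarlyAppointmentsCombGHelpers.G f (c x₀ h) (c x₀ h) - ext_pole_sum (c x₀ h)).im := by
        simp only [Complex.sub_im]
      rw [h2]
      calc |(EarlyAppointmentsCombGHelpers.G f (c x₀ h) (c x₀ h) - ext_pole_sum (c x₀ h)).im|
          ≤ ‖EarlyAppointmentsCombGHelpers.G f (c x₀ h) (c x₀ h) - ext_pole_sum (c x₀ h)‖ :=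
            Complex.abs_im_le_norm _
        _ ≤ η / s := h_G_ext_limit
    linarith [abs_le.mp h1]

  -- ext_pole_sum(c).im ≤ conjugate_im + comb_im
  have hc_in : c x₀ h ∈ hzeros_finite.toFinset := by rwa [Set.Finite.mem_toFinset]

  have h_ext_im_bound : (ext_pole_sum (c x₀ h)).im ≤ conjugate_im + comb_im := by
    simp only [ext_pole_sum, conjugate_im, comb_im]
    rw [finsum_mem_eq_finite_toFinset_sum _ hzeros_finite]
    exact GDecompFinsum.finsum_im_bound hh hhR hz₀_conj honly_pair hzeros_finite hc_in S hS

  linarith [h_G_im_bound, h_ext_im_bound]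

end GDecompLimit

end
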